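import Summits.QuantumFields.YangMills.Theorems.FemtoCutoffLadderWalledL2
import Summits.QuantumFields.YangMills.Theorems.FlatTubeReductionOffTubeSuppressionPrelim
import Summits.QuantumFields.YangMills.Theorems.LuscherReductionRunningReductionKTDoor
import Literature.Analysis.OperatorTheory.CompactPositiveMinMaxLevels
import HarnessLib

/-!
# Walled SPECTRAL IDENTIFICATION (brick 3 of the walled spectral package — route `FemtoCutoffLadder`, crux `LocalWallStep`
# stmt-QuantumFields-26282, cancellation route): the first two eigenvalues of the hard-wall compression ARE the tree's walled `t` and `s`

Seat `leafhand-qf-femtocutoffladder-2` g0 (2026-08-30), `--supports stmt-QuantumFields-26282`.  For an invariant measurable good set `S`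
with infinite-dimensional walled subspace (brick 2 ✓p796354) and the hard-wall compression `T_S` of the `L²` transfer operator (brick 1
✓p796175, `exists_walledOp`): Lit `exists_orthonormal_eigenvectors_antitone` gives orthonormal eigenvectors `e₀, e₁, …` of `T_S` in
`walledL2 L S` with antitone eigenvalues dominating the Rayleigh quotient, and Lit `isGLB_minmax_of_dense_constraints` over the DENSE walled
core identifies (§2, ★ `exists_walledEigen`)
  `ev₀ = t_S := sSup (rayleighSet su2Rep L β W_S)`,  `ev₁ = s_S := inf_φ sSup (rayleighSet su2Rep L β (W_S ∧ · ⊥ φ))`,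
`W_S ψ := ∀ U ∉ S, ψ U = 0` — the tree's walled values (items 26282/26631/26638/26197/25695 spell `S = {¬ bad}`).  Point of the `s`-clause:
the tree's infimum runs over ALL physical constraints `φ`, the GLB over walled ones; they agree because for walled `ψ`,
`ψ ⊥ φ ⇔ ψ ⊥ 1_S φ` and `1_S φ` is walled (§1).
Remaining bricks: honest representatives `φ_j = ev_j⁻¹ · 1_S · K_β e_j` (physical, walled, pointwise walled eigen-equation; needs
`P_{walledL2} = 1_S·` on `physL2`), walled Jentzsch, Doob identity (✓`energy_mul_eq`), and the XL one-more-wall comparison.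
HONEST FRAMING: fixed-lattice functional analysis; R2b1 RECORD rung — not infinite volume, not a mass gap, not Clay; no summit is proved by this
file.  No definitions, no named facts, no `sorry`.  [cite: ReedSimonIV1978, Thm. XIII.1] [cite: ReedSimonI1980, Thm. VI.16]
-/

set_option autoImplicit false

noncomputable section

open MeasureTheory Filter Topology Real
open Literature.MathematicalPhysics.QuantumFieldTheory
open Literature.MathematicalPhysics.QuantumLattice
open Literature.Analysis.OperatorTheory
open scoped InnerProductSpace

namespace Summit.QuantumFields.YangMills.Theorems.FemtoTransferGap.PhysL2

open Summit.QuantumFields.YangMills.Theorems.FemtoTransferGap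

variable {L : ℕ} [NeZero L]

/-! ## §1 The dense walled core; walled test functions as elements of the walled subspace -/

/-- A walled test function's class as an element of the walled closed subspace. [folklore] -/
def toW {S : Set (GaugeConfig 3 L SU2)} (ψ : physSubmodule L) (hψ : ψ ∈ walledSub L S) : walledL2 L S :=
  ⟨toL2 ψ, walledCore_le_walledL2 S (toL2_mem_walledCore hψ)⟩

/-- Underlying class of `toW`. [folklore] -/
@[simp] theorem coe_toW {S : Set (GaugeConfig 3 L SU2)} (ψ : physSubmodule L) (hψ : ψ ∈ walledSub L S) :
    ((toW ψ hψ : walledL2 L S) : Lp ℝ 2 (configMeasure SU2 L)) = toL2 ψ := rfl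

/-- The walled core seen inside the walled closed subspace. [cite: ReedSimonIV1978, Thm. XIII.2] -/
def walledCoreIn (S : Set (GaugeConfig 3 L SU2)) : Submodule ℝ (walledL2 L S) := (walledCore L S).comap (walledL2 L S).subtype

/-- Membership in `walledCoreIn`. [folklore] -/
theorem mem_walledCoreIn_iff {S : Set (GaugeConfig 3 L SU2)} {x : walledL2 L S} :
    x ∈ walledCoreIn S ↔ (x : Lp ℝ 2 (configMeasure SU2 L)) ∈ walledCore L S := Iff.rfl

/-- `toW ψ` lies in the core. [folklore] -/
theorem toW_mem_walledCoreIn {S : Set (GaugeConfig 3 L SU2)} (ψ : physSubmodule L) (hψ : ψ ∈ walledSub L S) :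
    toW ψ hψ ∈ walledCoreIn S := by
  rw [mem_walledCoreIn_iff, coe_toW]; exact toL2_mem_walledCore hψ

/-- Core elements are `toW` of walled test functions. [folklore] -/
theorem exists_eq_toW_of_mem_walledCoreIn {S : Set (GaugeConfig 3 L SU2)} {x : walledL2 L S} (hx : x ∈ walledCoreIn S) :
    ∃ (ψ : physSubmodule L) (hψ : ψ ∈ walledSub L S), toW ψ hψ = x := by
  obtain ⟨ψ, hψ, h⟩ := mem_walledCore_iff.mp (mem_walledCoreIn_iff.mp hx)
  exact ⟨ψ, hψ, Subtype.ext h⟩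

/-- **The walled core is dense in the walled closed subspace** (the latter is the closure of the former). [cite: ReedSimonIV1978, Thm. XIII.2] -/
theorem dense_walledCoreIn (S : Set (GaugeConfig 3 L SU2)) : Dense (walledCoreIn S : Set (walledL2 L S)) := by
  rw [Subtype.dense_iff]
  intro v hv
  have hv' : v ∈ closure (walledCore L S : Set (Lp ℝ 2 (configMeasure SU2 L))) := by
    have := Submodule.topologicalClosure_coe (walledCore L S)
    rw [walledL2] at hv
    rw [← this]; exact hv
  refine closure_mono ?_ hv'
  intro w hw
  exact ⟨⟨w, walledCore_le_walledL2 S hw⟩, (mem_walledCoreIn_iff).mpr hw, rfl⟩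

omit [NeZero L] in
/-- The cut `1_S φ` of a physical `φ` is walled (for measurable, gauge- and twist-invariant `S`). [folklore] -/
theorem indicator_mem_walledSub {S : Set (GaugeConfig 3 L SU2)} (hSm : MeasurableSet S)
    (hSg : ∀ (g : Site 3 L → SU2) (U : GaugeConfig 3 L SU2), gaugeTransform g U ∈ S ↔ U ∈ S)
    (hSz : ∀ (k : Fin 3), ∀ z ∈ Subgroup.center SU2, ∀ U : GaugeConfig 3 L SU2, twist k z U ∈ S ↔ U ∈ S)
    {φ : GaugeConfig 3 L SU2 → ℝ} (hφ : IsPhys φ) :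
    (⟨S.indicator φ, OffTube.isPhys_indicator hSm hSg hSz hφ⟩ : physSubmodule L) ∈ walledSub L S := fun U hU => by
  change S.indicator φ U = 0
  exact Set.indicator_of_notMem hU _

/-- For walled `ψ`: `⟨ψ, 1_S φ⟩ = ⟨ψ, φ⟩`. [folklore] -/
theorem l2_indicator_right_of_walled {S : Set (GaugeConfig 3 L SU2)} {ψ : GaugeConfig 3 L SU2 → ℝ}
    (hψS : ∀ U, U ∉ S → ψ U = 0) (φ : GaugeConfig 3 L SU2 → ℝ) : l2 ψ (S.indicator φ) = l2 ψ φ := by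
  unfold l2
  refine integral_congr_ae (ae_of_all _ fun U => ?_)
  by_cases hU : U ∈ S
  · simp only [Set.indicator_of_mem hU]
  · simp only [Set.indicator_of_notMem hU, hψS U hU, zero_mul]

/-! ## §2 ★ Walled spectral identification -/

/-- ★ **Walled eigenvectors and the identification of the first two eigenvalues with the tree's walled values.**  `β ≥ 0`; `A` the `L²`
transfer operator; `S` measurable, gauge- and twist-invariant with `walledL2 L S` infinite-dimensional.  For every `n` there are a bounded
self-adjoint compact positive `T` on `walledL2 L S` with the form of `A`, orthonormal `e : Fin n → walledL2 L S` and antitone `ev` with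
`T e_j = ev_j e_j`, domination off `e_{<j}`, and: `ev_j = t_S` when `j = 0`, `ev_j = s_S` when `j = 1`. [cite: ReedSimonIV1978, Thm. XIII.1–2] -/
theorem exists_walledEigen {β : ℝ} (hβ : 0 ≤ β) {A : Lp ℝ 2 (configMeasure SU2 L) →L[ℝ] Lp ℝ 2 (configMeasure SU2 L)}
    (hA : ∀ v : Lp ℝ 2 (configMeasure SU2 L),
      (A v : GaugeConfig 3 L SU2 → ℝ) =ᵐ[configMeasure SU2 L] fun U => ∫ V, transferKernel su2Rep β U V * v V ∂configMeasure SU2 L)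
    (hAsa : IsSelfAdjoint A) (hAc : IsCompactOperator A) {S : Set (GaugeConfig 3 L SU2)} (hSm : MeasurableSet S)
    (hSg : ∀ (g : Site 3 L → SU2) (U : GaugeConfig 3 L SU2), gaugeTransform g U ∈ S ↔ U ∈ S)
    (hSz : ∀ (k : Fin 3), ∀ z ∈ Subgroup.center SU2, ∀ U : GaugeConfig 3 L SU2, twist k z U ∈ S ↔ U ∈ S)
    (hinf : ¬ FiniteDimensional ℝ (walledL2 L S)) (n : ℕ) :
    ∃ (T : walledL2 L S →L[ℝ] walledL2 L S) (e : Fin n → walledL2 L S) (ev : Fin n → ℝ),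
      (∀ v w : walledL2 L S, ⟪v, T w⟫_ℝ = ⟪(v : Lp ℝ 2 (configMeasure SU2 L)), A w⟫_ℝ) ∧
      Orthonormal ℝ e ∧ (∀ j, T (e j) = ev j • e j) ∧ Antitone ev ∧
      (∀ (j : Fin n) (x : walledL2 L S), (∀ i : Fin n, i < j → ⟪e i, x⟫_ℝ = 0) → ⟪x, T x⟫_ℝ ≤ ev j * ‖x‖ ^ 2) ∧
      (∀ j : Fin n, (j : ℕ) = 0 →
        ev j = sSup (rayleighSet su2Rep L β fun ψ => ∀ U : GaugeConfig 3 L SU2, U ∉ S → ψ U = 0)) ∧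
      (∀ j : Fin n, (j : ℕ) = 1 →
        ev j = sInf {x : ℝ | ∃ φ : GaugeConfig 3 L SU2 → ℝ, IsPhys φ ∧
          x = sSup (rayleighSet su2Rep L β fun ψ => (∀ U : GaugeConfig 3 L SU2, U ∉ S → ψ U = 0) ∧ l2 ψ φ = 0)}) := by
  classical
  obtain ⟨T, hin, hTsa, hTc, hTpos, hTcore⟩ := exists_walledOp hA hAsa hAc S
  have hpos : ∀ x : walledL2 L S, 0 ≤ RCLike.re ⟪x, T x⟫_ℝ := fun x => by
    rw [RCLike.re_to_real]; exact hTpos hβ x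
  have hsym : ∀ x y : walledL2 L S, ⟪T x, y⟫_ℝ = ⟪x, T y⟫_ℝ := fun x y =>
    (ContinuousLinearMap.isSelfAdjoint_iff_isSymmetric.1 hTsa) x y
  obtain ⟨e, ev, hon, heig, hanti, hdom⟩ :=
    exists_orthonormal_eigenvectors_antitone (𝕜 := ℝ) hinf hTsa hTc hpos n
  have heig' : ∀ j, T (e j) = ev j • e j := fun j => by simpa using heig j
  have hdom' : ∀ (j : Fin n) (x : walledL2 L S), (∀ i : Fin n, i < j → ⟪e i, x⟫_ℝ = 0) → ⟪x, T x⟫_ℝ ≤ ev j * ‖x‖ ^ 2 :=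
    fun j x hx => by have h := hdom j x hx; rwa [RCLike.re_to_real] at h
  have hglb := fun j : Fin n =>
    isGLB_minmax_of_dense_constraints (𝕜 := ℝ) hsym hpos hon heig hanti hdom (walledCoreIn S) (dense_walledCoreIn S) j
  -- dictionary on the walled core
  have hcoreT : ∀ (ψ : physSubmodule L) (hψ : ψ ∈ walledSub L S),
      ⟪toW ψ hψ, T (toW ψ hψ)⟫_ℝ = qform su2Rep β (ψ : GaugeConfig 3 L SU2 → ℝ) ψ := fun ψ hψ => hTcore ψ ψ hψ hψ
  have hcoreN : ∀ (ψ : physSubmodule L) (hψ : ψ ∈ walledSub L S),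
      ‖toW ψ hψ‖ ^ 2 = l2 (ψ : GaugeConfig 3 L SU2 → ℝ) ψ := fun ψ hψ => by
    rw [Submodule.coe_norm]; exact norm_sq_toL2 ψ
  have hcoreI : ∀ (ψ φ : physSubmodule L) (hψ : ψ ∈ walledSub L S) (hφ : φ ∈ walledSub L S),
      ⟪toW ψ hψ, toW φ hφ⟫_ℝ = l2 (ψ : GaugeConfig 3 L SU2 → ℝ) φ := fun ψ φ hψ hφ => by
    rw [Submodule.coe_inner]; exact inner_toL2 ψ φ
  have hevnn : ∀ j, 0 ≤ ev j := fun j => ev_nonneg hpos hon heig j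
  -- a Rayleigh bound on a walled core element from membership of its quotient in a bounded Rayleigh set
  have hRay : ∀ (P : (GaugeConfig 3 L SU2 → ℝ) → Prop) (ψ : physSubmodule L) (hψ : ψ ∈ walledSub L S),
      P ψ → ⟪toW ψ hψ, T (toW ψ hψ)⟫_ℝ ≤ sSup (rayleighSet su2Rep L β P) * ‖toW ψ hψ‖ ^ 2 := by
    intro P ψ hψ hP
    rw [hcoreT, hcoreN]
    rcases (l2_self_nonneg (ψ : GaugeConfig 3 L SU2 → ℝ)).eq_or_lt with h0 | hp
    · rw [← h0, mul_zero, qform_eq_zero_of_l2_eq_zero β (isPhys_coe ψ) h0.symm]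
    · have hmem : qform su2Rep β (ψ : GaugeConfig 3 L SU2 → ℝ) ψ / l2 (ψ : GaugeConfig 3 L SU2 → ℝ) ψ ∈
          rayleighSet su2Rep L β P := ⟨ψ, isPhys_coe ψ, hP, hp, rfl⟩
      have hle := le_csSup (bddAbove_rayleighSet su2Rep continuous_su2Rep β _) hmem
      rwa [div_le_iff₀ hp] at hle
  refine ⟨T, e, ev, hin, hon, heig', hanti, hdom', fun j hj0 => ?_, fun j hj1 => ?_⟩
  · -- `ev j = t_S` for `j = 0`
    apply le_antisymm
    · -- `ev j ≤ t_S`: `t_S` is an admissible bound with NO constraints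
      refine (hglb j).1 ⟨fun l => (Fin.cast hj0 l).elim0, fun l => (Fin.cast hj0 l).elim0, fun x hx _ => ?_⟩
      obtain ⟨ψ, hψ, rfl⟩ := exists_eq_toW_of_mem_walledCoreIn hx
      rw [RCLike.re_to_real]
      exact hRay _ ψ hψ hψ
    · -- `t_S ≤ ev j`
      refine le_of_forall_pos_lt_add fun ε hε => ?_
      obtain ⟨s, ⟨χ, -, hχ⟩, -, hslt⟩ := (hglb j).exists_between (lt_add_of_pos_right _ hε)
      have h2 : sSup (rayleighSet su2Rep L β fun ψ => ∀ U : GaugeConfig 3 L SU2, U ∉ S → ψ U = 0) ≤ max s 0 := by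
        refine Real.sSup_le ?_ (le_max_right _ _)
        rintro r ⟨ψ', hψ', hP, hp, rfl⟩
        refine (le_max_left s 0).trans' ?_
        rw [div_le_iff₀ hp]
        have hperp : ∀ l : Fin j, ⟪χ l, toW ⟨ψ', hψ'⟩ hP⟫_ℝ = 0 := fun l => (Fin.cast hj0 l).elim0
        have h := hχ (toW ⟨ψ', hψ'⟩ hP) (toW_mem_walledCoreIn _ _) hperp
        rwa [RCLike.re_to_real, hcoreT, hcoreN] at h
      have h3 : max s 0 < ev j + ε := max_lt hslt (lt_add_of_le_of_pos (hevnn j) hε)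
      linarith
  · -- `ev j = s_S` for `j = 1`
    have hj : 0 < (j : ℕ) := by omega
    apply le_antisymm
    · -- `ev j ≤ s_S`: every physical constraint `φ` gives an admissible bound via the walled constraint `1_S φ`
      refine le_csInf ⟨_, fun _ => 1, isPhys_const 1, rfl⟩ ?_
      rintro x ⟨φ, hφ, rfl⟩
      have hφSw := indicator_mem_walledSub hSm hSg hSz hφ
      refine (hglb j).1 ⟨fun _ => toW _ hφSw, fun _ => toW_mem_walledCoreIn _ _, fun x hx hperp => ?_⟩
      obtain ⟨ψ, hψ, rfl⟩ := exists_eq_toW_of_mem_walledCoreIn hx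
      rw [RCLike.re_to_real]
      refine hRay _ ψ hψ ⟨hψ, ?_⟩
      have h := hperp ⟨0, by omega⟩
      rw [hcoreI] at h
      -- `h : l2 (1_S φ) ψ = 0`; convert to `l2 ψ φ = 0`
      rw [l2_comm] at h
      have h' : l2 (ψ : GaugeConfig 3 L SU2 → ℝ) (S.indicator φ) = 0 := h
      rwa [l2_indicator_right_of_walled hψ] at h'
    · -- `s_S ≤ ev j`
      refine le_of_forall_pos_lt_add fun ε hε => ?_
      obtain ⟨s, ⟨χ, hχD, hχ⟩, -, hslt⟩ := (hglb j).exists_between (lt_add_of_pos_right _ hε)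
      obtain ⟨χ₀, hχ₀, hχ₀eq⟩ := exists_eq_toW_of_mem_walledCoreIn (hχD ⟨0, by omega⟩)
      have h1 : sInf {x : ℝ | ∃ φ : GaugeConfig 3 L SU2 → ℝ, IsPhys φ ∧
          x = sSup (rayleighSet su2Rep L β fun ψ => (∀ U : GaugeConfig 3 L SU2, U ∉ S → ψ U = 0) ∧ l2 ψ φ = 0)} ≤
          sSup (rayleighSet su2Rep L β fun ψ => (∀ U : GaugeConfig 3 L SU2, U ∉ S → ψ U = 0) ∧
            l2 ψ (χ₀ : GaugeConfig 3 L SU2 → ℝ) = 0) := by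
        refine csInf_le ⟨0, ?_⟩ ⟨(χ₀ : GaugeConfig 3 L SU2 → ℝ), isPhys_coe χ₀, rfl⟩
        rintro t ⟨φ', -, rfl⟩
        refine Real.sSup_nonneg ?_
        rintro r ⟨ψ', hψ', -, hp, rfl⟩
        exact div_nonneg (qform_su2Rep_self_nonneg hβ hψ') hp.le
      have h2 : sSup (rayleighSet su2Rep L β fun ψ => (∀ U : GaugeConfig 3 L SU2, U ∉ S → ψ U = 0) ∧
            l2 ψ (χ₀ : GaugeConfig 3 L SU2 → ℝ) = 0) ≤ max s 0 := by
        refine Real.sSup_le ?_ (le_max_right _ _)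
        rintro r ⟨ψ', hψ', ⟨hP, hperp0⟩, hp, rfl⟩
        refine (le_max_left s 0).trans' ?_
        rw [div_le_iff₀ hp]
        have hperp : ∀ l : Fin j, ⟪χ l, toW ⟨ψ', hψ'⟩ hP⟫_ℝ = 0 := by
          intro l
          have hl : l = ⟨0, by omega⟩ := Fin.ext (by have := l.isLt; omega)
          rw [hl, ← hχ₀eq, hcoreI, l2_comm]
          exact hperp0
        have h := hχ (toW ⟨ψ', hψ'⟩ hP) (toW_mem_walledCoreIn _ _) hperp
        rwa [RCLike.re_to_real, hcoreT, hcoreN] at h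
      have h3 : max s 0 < ev j + ε := max_lt hslt (lt_add_of_le_of_pos (hevnn j) hε)
      linarith

end Summit.QuantumFields.YangMills.Theorems.FemtoTransferGap.PhysL2

end
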